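import Summits.QuantumFields.BalabanUV.T4Continuum.Spine.NE4.Necessity
import Summits.QuantumFields.YangMills.Theorems.BalabanUVNodesN17KnitTransfer

/-!
# NODE N17 (NE4) — THE RUN-WINDOW N17 TEXT FEEDS K3's `hU2` SLOT: a by-name junction from dag-n17-w1's run-window letter to the
# (pre-existing) RUN-keyed node-U2 door `Spine/NE4/Necessity` ∕ `Support/NE7MarginalL1Runs`

Cell `pub-ymgap`, YM-PLAN Track A (HUMAN RULINGS D-0062 ∕ D-0149), WIDTH SEAT `pub-ymgap-dag-n17-w3` (generation 5).  Key K3⁸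
stmt-QuantumFields-27366 `SpineGivenEndpointR13SepCoPHV` (`--kind proof --supports stmt-QuantumFields-27366 --as helper`, COUNT-NEUTRAL; KEY MAP v2).
Lineage: this seat's g3 FILE 2 `…N17U2OutputOfKeyedRatesFSC` (p603039: node U2's OUTPUT edge — the N27 joins' `hU2` slot
`D.UnderHypotheses _ (fun g₀ ↦ U2Output D g₀ Cout ρ′)` — from the BOX-keyed letters (D4) ∧ N18 ∧ N22 at the K3 pin).

LOCATED (the point of this file, said first).  The RUN-keyed node-U2 door that a run-keyed re-cut of K3 would need for the `hU2` slot is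
ALREADY IN THE TREE, typed by cell `pub-balaban-gaps` (seat `ne4` g2 and the NE7-ℓ¹ lineage), and is NOT re-typed here:
* `Spine/NE4/Necessity.disc_le_of_shiftAlong_geom` — node U2's main form with `T4CouplingMatching.ScaleShiftRate c θ γ β` (a bound on the
  whole box) weakened to `NE7MarginalL1Currency.ShiftAlongRun (fun j ↦ cθ^j) β gB K` (the shift read ONLY at run B's realised prefixes);
  `Spine/NE4/Necessity.u2Output_of_ne4AlongRuns` (on the data: `U2Output D g₀ (2c∕(1−θ)) θ`) and its CONVERSE `ne4AlongRuns_of_u2Output`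
  (node U2's output FORCES NE4 along the tuned runs — the box quantifier is the only slack, and `disc_step` never reads it);
* `Support/NE7MarginalL1Runs.disc_le_of_shiftAlong_fadingMemory` ∕ `disc_runs_le_smear_fadingMemory` — the SUMMABLE-modulus (ℓ¹) currency:
  a shift sequence `σ ≥ 0` along the runs gives `disc_j ≤ 2·Σ_{l<K} σ_l·ω^{(j−l)₊}` (`SmearDominated 2 ω σ`), and
  `Support/NE7MarginalL1Currency.summable_delta_of_smearDominated` turns `Σσ < ∞` into node U6's summable transported totals
  (`thresholdExact`: nothing weaker than ℓ¹ passes the δ-road).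
THE FREE PIECE typed here: the cell's own RUN-WINDOW N17 text — dag-n17-w1 FILE 5 (p608124 `…N17RunWindowShift`) hypothesis `hW`, reproduced
VERBATIM as a binder (FILE 5 is not imported: theses-cone hygiene) —
  `∀ n gs, RGEqH n β gs → Step.InInterval γ n gs → ∀ j k, j + (k+1) ≤ n → |β (k+1) (prefixOf (fun i ↦ gs (j+i)) (k+1)) − β k (prefixOf (fun i ↦ gs (j+1+i)) k)| ≤ a k`
(the β-shift along EVERY sliding window of EVERY in-window run of (0.20)), read at window start `j = 0`, IS `ShiftAlongRun a β gs n` for that run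
(`shiftAlongRun_of_runWindowShift`, `T4CouplingMatching.tail_prefixOf`).  Hence ONE hypothesis text of this cell feeds THREE roads by name: the K2⁷ corner road
(FILE 5 `exists_runConstRemainder_of_runWindowShift_cornerStep_scaleAnchor`), the K1 rows road, AND — this file — K3's `hU2` slot.

WHAT THIS FILE PROVES (theorems only; 0 `def`, 0 `instance`, 0 `sorry`; imports `Spine/NE4/Necessity` (which brings `Spine/NE4/Targets`, `T4CouplingMatching`,
`Support/NE7MarginalL1Runs∕Currency`) and this lineage's `…N17KnitTransfer` (for `T4CurrencyMatching` and `gapWindow_of_small_box`); every cited theorem used BY NAME):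
§1 generic `β : HBeta` — `shiftAlongRun_of_runWindowShift`; `disc_le_geom_of_runWindowShift` (two IR-pinned in-window runs, `a_k ≤ cθ^k`, the history half
   `HistLipschitz Λ γ β` ∧ `FadingMemory C θ Λ`, AF weight `Σ_{i≤K}(g^A_i)²g^B_{i+1} ≤ U`, window `C·U ≤ (1−θ)∕2` ⟹ `disc ≤ (2c∕(1−θ))θ^j`, K-uniform);
   `disc_le_gap_of_runWindowShift` (the AF-FREE RATE-LOSS road of `T4CurrencyMatching` ∕ `…N17KnitTransfer` §11 ALONG RUN B — new as a kernel use, not as an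
   idea: `NE7MarginalL1Runs.disc_step_along` + `T4CurrencyMatching.twoSided_fixedPoint_rateLoss` with the box weight `(g^A_i)²g^B_{i+1} ≤ γ³`: memory rate `ω < ρ`,
   output rate `ρ ≥ θ`, ONE window `C·γ³·ρ∕(ρ−ω) ≤ (1−ρ)∕2`, NO weight sum, NO β lower bound ⟹ `disc ≤ (2c∕(1−ρ))ρ^j`);
   `disc_le_smear_of_runWindowShift` (any `a ≥ 0`, memory rate `ω` ⟹ `disc_j ≤ 2Σ_{l<K} a_l ω^{(j−l)₊}`).
§2 on Bałaban's data `D : FiniteEpsData F G` along a TUNED bare-coupling sequence ([I] Thm 2: every run in `]0,γ]`, `g_K = g`) —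
   `shiftAlongRun_runFlow_of_runWindowShift`; ★ `u2Output_of_runWindowShift` (`U2Output D g₀ (2c∕(1−θ)) θ`);
   ★★ `underHypotheses_u2Output_of_runWindowShift` (`D.UnderHypotheses Hβ (fun g₀ ↦ U2Output D g₀ (2c∕(1−θ)) θ)` — the `hU2` SLOT SHAPE of the N27 joins —
   from `hW` at level `γᵤ` + the history half + the AF binders on `]0,γᵤ]`: the twin of `Spine/NE4/Targets.u2Output_under` with the BOX letter replaced by the
   RUN-WINDOW text); ★★ `u2Output_of_runWindowShift_gap` ∕ ★★★ `underHypotheses_u2Output_of_runWindowShift_gap` (the AF-FREE twins — NO `EventualLowerH`,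
   NO window binder, the γ³-window discharged by `γ` small inside the prefix (`…N17KnitTransfer.gapWindow_of_small_box`): EXACTLY the road and the shape by which
   the `hU2` slot is supplied TODAY — `…N17KnitTransfer.u2Output_under_of_N17_gap` from the box letter, this seat's g3 FILE 2 at the K3 pin — now from the run-window
   text); `smearDominated_disc_of_runWindowShift` and `summable_delta_of_runWindowShift` (the honest downstream face of a merely SUMMABLE
   run-window modulus — R-N17-RUN of `HOME/pub-ymgap-dag-n17-w1/LOCATED-R-N17-RUN-n17-w1-g6.md` —: NOT `U2Output` as typed (geometric), but node U6's
   `Summable (T4CauchySum.delta E ρ ·)` all the same).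
F-E STATUS (located, ym-nodeO CRIT-1∕CRIT-2; dag-n17-w1 FILES 7∕8): under H_FE′ + (T) the history half's `FadingMemory` is the presumptively-dead binder of
every theorem below exactly as it is in `Targets.u2Output_under` — DISPLAYED here, not repaired (the F-E desk's question); the run-window keying of N17 itself
is the F-E-robust part (dag-n17-w1 FILE 8's toy meets `hW` with a summable `a` while refuting the box letter).

HONEST SCOPE (A6, director-ym №189).  Elementary bookkeeping over hypothesis SHAPES (`hW`, history moduli, fading memory, `EventualLowerH`, `BetaUpperH`,
tuned sequences, the window) + landed tree theorems BY NAME; NOTHING of Bałaban is asserted, inhabited, discharged or refuted; NE4 is NOT IN PRINT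
([Balaban1987RG1] p. 264 «We will investigate other properties in a separate paper»; GAPS G-t4-U2-1) and NOT proved in any keying; NOT a proof of
`stub_rates13HV` ∕ `stub_expansion13HV`; N17 NOT discharged (DEPENDENT∕DERIVED row); K0⁷ ∕ K1⁹ ∕ K3⁸ OPEN, skeleton v6 untouched; counts UNMOVED
(typed 28∕28 · discharged 5∕27 · A 5∕28).  One finite four-torus programme at fixed `ε = L^{−K}`, Bałaban AS PRINTED; the YM mass gap (Clay) is
NOT proved by any of this — R4 closes the conditional finite-𝕋⁴ rung `BalabanLadder.UV` only; nothing continuum ∕ ℝ⁴ ∕ OS.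
[I] = [Balaban1987RG1] T. Bałaban, CMP **109** (1987): (0.20) p. 256, Thm 2 p. 259, (1.20)–(1.22) p. 264, Thm 3 p. 264, §5 p. 298.
-/

noncomputable section

namespace YMDAG.N17.RunWindowU2Door

open Finset
open Literature.MathematicalPhysics.QuantumFieldTheory.Balaban1983to89
open Literature.MathematicalPhysics.QuantumFieldTheory.Balaban1983to89.FlowStep
open Literature.MathematicalPhysics.QuantumFieldTheory.Balaban1983to89.T4CouplingMatching
open Literature.MathematicalPhysics.QuantumFieldTheory.Balaban1983to89.T4Continuum
open Literature.MathematicalPhysics.QuantumFieldTheory.Balaban1983to89.T4TwoRunUniqueness (rgEqH_of_tuned)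
open Summit.QuantumFields.BalabanUV.T4Continuum.NE7MarginalL1Currency (ShiftAlongRun SmearDominated smear summable_delta_of_smearDominated)
open Summit.QuantumFields.BalabanUV.T4Continuum.NE7MarginalL1Runs (disc_le_of_shiftAlong_fadingMemory disc_runs_le_smear_fadingMemory)
open Literature.MathematicalPhysics.QuantumFieldTheory.Balaban1983to89.T4CurrencyMatching (twoSided_fixedPoint_rateLoss)
open Summit.QuantumFields.BalabanUV.T4Continuum.NE7MarginalL1Runs (disc_step_along)
open Summit.QuantumFields.BalabanUV.T4Continuum.Spine.NE4
  (U2Output runFlow box_and_pin_of_tuned disc_le_of_shiftAlong_geom u2Output_of_ne4AlongRuns)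
open Summit.QuantumFields.YangMills.Theorems.BalabanUVNodesN17 (gapWindow_of_small_box)

/-! ## §1 Generic `β : HBeta`: the run-window text at window start `0` is `ShiftAlongRun`; the two-run discrepancy bounds BY NAME -/

section Generic

variable {β : HBeta} {γ : ℝ} {a : ℕ → ℝ}

/-- **THE RUN-WINDOW N17 TEXT, READ AT WINDOW START `j = 0`, IS `ShiftAlongRun`.**  dag-n17-w1's hypothesis text `hW` (FILE 5 p608124, verbatim:
the β-shift `|β_{k+2}(g_j,…,g_{j+k+1}) − β_{k+1}(g_{j+1},…,g_{j+k+1})| ≤ a_k` along every sliding window of every in-window run of (0.20)) gives, for any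
ONE in-window run `gs` of `n` steps (`RGEqH n β gs`, `Step.InInterval γ n gs`), the NE7-ℓ¹ lineage's supplier shape
`NE7MarginalL1Currency.ShiftAlongRun a β gs n` (`|β (k+1) (prefixOf gs (k+1)) − β k (Fin.tail (prefixOf gs (k+1)))| ≤ a k` for `k < n`):
take the window starting at `0`; `Fin.tail (prefixOf gs (k+1)) = prefixOf (fun i ↦ gs (i+1)) k` is `T4CouplingMatching.tail_prefixOf`.
Both sides are hypothesis SHAPES; nothing of [Balaban1987RG1] is asserted. [cite: Balaban1987RG1, (0.20) p.256 and (1.20)-(1.22) p.264] -/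
theorem shiftAlongRun_of_runWindowShift
    (hW : ∀ (n : ℕ) (gs : ℕ → ℝ), RGEqH n β gs → Step.InInterval γ n gs → ∀ j k : ℕ, j + (k + 1) ≤ n →
      |β (k + 1) (prefixOf (fun i => gs (j + i)) (k + 1)) - β k (prefixOf (fun i => gs (j + 1 + i)) k)| ≤ a k)
    {n : ℕ} {gs : ℕ → ℝ} (hrg : RGEqH n β gs) (hI : Step.InInterval γ n gs) :
    ShiftAlongRun a β gs n := by
  intro k hk
  have h := hW n gs hrg hI 0 k (by omega)
  have e1 : (fun i : ℕ => gs (0 + i)) = gs := funext fun i => by rw [Nat.zero_add]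
  have e2 : (fun i : ℕ => gs (0 + 1 + i)) = fun i => gs (i + 1) := funext fun i => by rw [Nat.zero_add, Nat.add_comm]
  rw [e1, e2, ← tail_prefixOf] at h
  exact h

/-- **NODE U2's MAIN (GEOMETRIC, K-UNIFORM) FORM FROM THE RUN-WINDOW TEXT** (`Spine/NE4/Necessity.disc_le_of_shiftAlong_geom` BY NAME).  Two runs of
(0.20) with the same history-dependent `β` — A: `K` steps, B: `K+1` steps — inside `]0,γ]` (`Step.InInterval`), infrared-pinned `g^A_K = g^B_{K+1}` ([I] Thm 2);
the run-window text with a GEOMETRIC modulus `a_k ≤ c·θ^k`; node U2's history half `HistLipschitz Λ γ β` ∧ `FadingMemory C θ Λ` (row NE9's shapes); the AF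
weight bound `Σ_{i≤K}(g^A_i)²g^B_{i+1} ≤ U` and the window `C·U ≤ (1−θ)∕2`.  THEN `|1∕(g^A_j)² − 1∕(g^B_{j+1})²| ≤ (2c∕(1−θ))·θ^j` for `j ≤ K`.  The run-window
text is used ONLY at run B's prefixes (`shiftAlongRun_of_runWindowShift`).  Every β-side hypothesis UNPRINTED. [cite: Balaban1987RG1, (0.20) p.256 and Thm 2 p.259] -/
theorem disc_le_geom_of_runWindowShift {c θ C U : ℝ} {Λ : ℕ → ℕ → ℝ} {K : ℕ} {gA gB : ℕ → ℝ}
    (hW : ∀ (n : ℕ) (gs : ℕ → ℝ), RGEqH n β gs → Step.InInterval γ n gs → ∀ j k : ℕ, j + (k + 1) ≤ n →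
      |β (k + 1) (prefixOf (fun i => gs (j + i)) (k + 1)) - β k (prefixOf (fun i => gs (j + 1 + i)) k)| ≤ a k)
    (hac : ∀ k, a k ≤ c * θ ^ k) (hθ0 : 0 < θ) (hθ1 : θ < 1) (hc : 0 ≤ c)
    (hA : RGEqH K β gA) (hB : RGEqH (K + 1) β gB)
    (hAbox : Step.InInterval γ K gA) (hBbox : Step.InInterval γ (K + 1) gB) (hpin : gA K = gB (K + 1))
    (hL : HistLipschitz Λ γ β) (hΛ : FadingMemory C θ Λ)
    (hU : ∑ i ∈ range (K + 1), (gA i) ^ 2 * gB (i + 1) ≤ U) (hsmall : C * U ≤ (1 - θ) / 2) :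
    ∀ j, j ≤ K → disc gA gB j ≤ 2 * c / (1 - θ) * θ ^ j :=
  disc_le_of_shiftAlong_geom hθ0 hθ1 hc hA hB (fun i hi => hAbox i hi) (fun i hi => hBbox i hi) hpin
    (fun j hj => (shiftAlongRun_of_runWindowShift hW hB hBbox j (Nat.lt_succ_of_lt hj)).trans (hac j)) hL hΛ hU hsmall

/-- **NODE U2's AF-FREE RATE-LOSS FORM FROM THE RUN-WINDOW TEXT, ALONG RUN B** (the road of `T4CurrencyMatching.disc_le_of_fadingMemory_by` ∕
`…N17KnitTransfer.u2Output_of_N17_gap`, read along the run: `NE7MarginalL1Runs.disc_step_along` + `T4CurrencyMatching.twoSided_fixedPoint_rateLoss` BY NAME).  Two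
IR-pinned in-window runs as above; the run-window text with `a_k ≤ c·θ^k`; the history half `HistLipschitz Λ γ β` ∧ `FadingMemory C ω Λ` with a STRICT memory gap
`0 ≤ ω < ρ`, output rate `ρ ∈ [θ,1[`; the box weight `(g^A_i)²g^B_{i+1} ≤ γ³` replaces pv16's weight SUM, so NO β lower bound ∕ asymptotic freedom enters; ONE window
`C·γ³·ρ∕(ρ−ω) ≤ (1−ρ)∕2` (true for `γ` small GIVEN `C, ρ, ω` — `gapWindow_of_small_box`).  THEN `|1∕(g^A_j)² − 1∕(g^B_{j+1})²| ≤ (2c∕(1−ρ))·ρ^j` for `j ≤ K`.  Every β-side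
hypothesis UNPRINTED; bookkeeping. [cite: Balaban1987RG1, (0.20) p.256, Thm 2 p.259 and §5 p.298] -/
theorem disc_le_gap_of_runWindowShift {c θ ω ρ C : ℝ} {Λ : ℕ → ℕ → ℝ} {K : ℕ} {gA gB : ℕ → ℝ}
    (hW : ∀ (n : ℕ) (gs : ℕ → ℝ), RGEqH n β gs → Step.InInterval γ n gs → ∀ j k : ℕ, j + (k + 1) ≤ n →
      |β (k + 1) (prefixOf (fun i => gs (j + i)) (k + 1)) - β k (prefixOf (fun i => gs (j + 1 + i)) k)| ≤ a k)
    (hac : ∀ k, a k ≤ c * θ ^ k) (hρ0 : 0 < ρ) (hρ1 : ρ < 1) (hθ0 : 0 ≤ θ) (hθρ : θ ≤ ρ) (hω0 : 0 ≤ ω) (hωρ : ω < ρ)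
    (hc : 0 ≤ c) (hC : 0 ≤ C)
    (hA : RGEqH K β gA) (hB : RGEqH (K + 1) β gB)
    (hAbox : Step.InInterval γ K gA) (hBbox : Step.InInterval γ (K + 1) gB) (hpin : gA K = gB (K + 1))
    (hL : HistLipschitz Λ γ β) (hΛ : FadingMemory C ω Λ)
    (hsmall : C * γ ^ 3 * (ρ / (ρ - ω)) ≤ (1 - ρ) / 2) :
    ∀ j, j ≤ K → disc gA gB j ≤ 2 * c / (1 - ρ) * ρ ^ j := by
  have hS : ShiftAlongRun a β gB (K + 1) := shiftAlongRun_of_runWindowShift hW hB hBbox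
  have hu : ∀ i, i ≤ K → 0 ≤ (gA i) ^ 2 * gB (i + 1) ∧ (gA i) ^ 2 * gB (i + 1) ≤ γ ^ 3 := by
    intro i hi
    have hgA := hAbox i hi
    have hgB := hBbox (i + 1) (by omega)
    refine ⟨mul_nonneg (sq_nonneg _) hgB.1.le, ?_⟩
    have h1 : (gA i) ^ 2 ≤ γ ^ 2 := pow_le_pow_left₀ hgA.1.le hgA.2 2
    calc (gA i) ^ 2 * gB (i + 1) ≤ γ ^ 2 * γ := mul_le_mul h1 hgB.2 hgB.1.le (sq_nonneg _)
      _ = γ ^ 3 := by ring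
  refine twoSided_fixedPoint_rateLoss (u := fun i => (gA i) ^ 2 * gB (i + 1)) (ubar := γ ^ 3)
    hρ0 hρ1 hθ0 hθρ hω0 hωρ hc hC (disc_nonneg gA gB) hu hsmall (disc_pin hpin) ?_
  intro j hj
  have hstep := disc_step_along hA hB (fun i hi => hAbox i hi) (fun i hi => hBbox i hi) hL
    (fun k i hik => (hΛ k i hik).1) hj ((hS j (Nat.lt_succ_of_lt hj)).trans (hac j))
  have hsum : ∑ i ∈ range (j + 1), Λ j i * ((gA i) ^ 2 * gB (i + 1)) * disc gA gB i
      ≤ C * ∑ i ∈ range (j + 1), ω ^ (j - i) * ((gA i) ^ 2 * gB (i + 1)) * disc gA gB i := by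
    rw [Finset.mul_sum]
    refine Finset.sum_le_sum fun i hi => ?_
    have hij : i ≤ j := Nat.lt_succ_iff.mp (mem_range.mp hi)
    have hiK : i ≤ K := by omega
    have hnn : 0 ≤ (gA i) ^ 2 * gB (i + 1) * disc gA gB i := mul_nonneg (hu i hiK).1 (disc_nonneg _ _ _)
    calc Λ j i * ((gA i) ^ 2 * gB (i + 1)) * disc gA gB i
        = Λ j i * ((gA i) ^ 2 * gB (i + 1) * disc gA gB i) := by ring
      _ ≤ C * ω ^ (j - i) * ((gA i) ^ 2 * gB (i + 1) * disc gA gB i) :=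
          mul_le_mul_of_nonneg_right (hΛ j i hij).2 hnn
      _ = C * (ω ^ (j - i) * ((gA i) ^ 2 * gB (i + 1)) * disc gA gB i) := by ring
  linarith [hstep, hsum]

/-- **NODE U2 IN THE SUMMABLE-MODULUS (ℓ¹) CURRENCY FROM THE RUN-WINDOW TEXT** (`Support/NE7MarginalL1Runs.disc_le_of_shiftAlong_fadingMemory` BY NAME).  The
same two pinned in-window runs; the run-window text with ANY modulus `a ≥ 0` (no rate asked — R-N17-RUN's «summable modulus» included); the history half with
memory rate `ω ∈ ]0,1[`; the AF weight bound and the window `C·U ≤ (1−ω)∕2`.  THEN for `j ≤ K`: `disc_j ≤ 2·Σ_{l<K} a_l·ω^{(j−l)₊}` — the tail `Σ_{l∈[j,K)} a_l`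
of the modulus plus the ω-faded leak of the older scales (`NE7MarginalL1Currency.smear ω a K j`).  Every β-side hypothesis UNPRINTED.
[cite: Balaban1987RG1, (0.20) p.256 and Thm 2 p.259] -/
theorem disc_le_smear_of_runWindowShift {ω C U : ℝ} {Λ : ℕ → ℕ → ℝ} {K : ℕ} {gA gB : ℕ → ℝ}
    (hW : ∀ (n : ℕ) (gs : ℕ → ℝ), RGEqH n β gs → Step.InInterval γ n gs → ∀ j k : ℕ, j + (k + 1) ≤ n →
      |β (k + 1) (prefixOf (fun i => gs (j + i)) (k + 1)) - β k (prefixOf (fun i => gs (j + 1 + i)) k)| ≤ a k)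
    (ha0 : ∀ k, 0 ≤ a k) (hω0 : 0 < ω) (hω1 : ω < 1) (hC : 0 ≤ C)
    (hA : RGEqH K β gA) (hB : RGEqH (K + 1) β gB)
    (hAbox : Step.InInterval γ K gA) (hBbox : Step.InInterval γ (K + 1) gB) (hpin : gA K = gB (K + 1))
    (hL : HistLipschitz Λ γ β) (hΛ : FadingMemory C ω Λ)
    (hU : ∑ i ∈ range (K + 1), (gA i) ^ 2 * gB (i + 1) ≤ U) (hsmall : C * U ≤ (1 - ω) / 2) :
    ∀ j, j ≤ K → disc gA gB j ≤ 2 * ∑ l ∈ range K, a l * ω ^ (j - l) :=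
  disc_le_of_shiftAlong_fadingMemory hω0 hω1 hC ha0 hA hB (fun i hi => hAbox i hi) (fun i hi => hBbox i hi) hpin
    (fun j hj => shiftAlongRun_of_runWindowShift hW hB hBbox j (Nat.lt_succ_of_lt hj)) hL hΛ hU hsmall

end Generic

/-! ## §2 On Bałaban's data along a TUNED bare-coupling sequence: K3's `hU2` conclusion and slot shape, and node U6's ℓ¹ face -/

section OnData

universe u

variable {F : T4Family} {G : Type u} [GaugeGroup G] [MeasurableSpace G] [HaarData G]

/-- **THE RUN-WINDOW TEXT ALONG THE DATA's TUNED RUNS.**  For Bałaban's data `D` and a bare-coupling sequence `g₀` TUNED to `g` within `]0,γ]`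
([I] Thm 2: `D.Tuned γ g g₀` — every run in the interval, `g_K = g`), with (0.20) run forward (`BetaUpperH β′ γ`, `γ²β′ < 1`:
`T4TwoRunUniqueness.rgEqH_of_tuned`), the run-window text for `D.βfun` at level `γ` gives `ShiftAlongRun a D.βfun (runFlow D g₀ (K+1)) K` for every `K`
— the `hS` binder of `Spine/NE4/Necessity.u2Output_of_ne4AlongRuns` and of `NE7MarginalL1Runs.disc_runs_le_smear_fadingMemory`.  Hypothesis shapes only.
[cite: Balaban1987RG1, (0.20) p.256 and Thm 2 p.259] -/
theorem shiftAlongRun_runFlow_of_runWindowShift (D : FiniteEpsData F G) {γ β' g : ℝ} {a : ℕ → ℝ} {g₀ : ℕ → ℝ}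
    (hW : ∀ (n : ℕ) (gs : ℕ → ℝ), RGEqH n D.βfun gs → Step.InInterval γ n gs → ∀ j k : ℕ, j + (k + 1) ≤ n →
      |D.βfun (k + 1) (prefixOf (fun i => gs (j + i)) (k + 1)) - D.βfun k (prefixOf (fun i => gs (j + 1 + i)) k)| ≤ a k)
    (hγ : 0 < γ) (hhi : BetaUpperH β' γ D.βfun) (hγβ : γ ^ 2 * β' < 1) (ht : D.Tuned γ g g₀) (K : ℕ) :
    ShiftAlongRun a D.βfun (runFlow D g₀ (K + 1)) K := by
  have hrun : RGEqH (K + 1) D.βfun (runFlow D g₀ (K + 1)) := rgEqH_of_tuned D hhi hγβ hγ le_rfl ht (K + 1)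
  have hI : Step.InInterval γ (K + 1) (runFlow D g₀ (K + 1)) := (ht (K + 1)).1
  intro j hj
  exact shiftAlongRun_of_runWindowShift hW hrun hI j (Nat.lt_succ_of_lt hj)

/-- ★ **K3's `hU2` CONCLUSION FROM THE RUN-WINDOW N17 TEXT** (`Spine/NE4/Necessity.u2Output_of_ne4AlongRuns` BY NAME).  The run-window text for `D.βfun` at
level `γ` with a geometric modulus `a_k ≤ cθ^k` (`0 < θ < 1`, `c ≥ 0`); node U2's history half `HistLipschitz Λ γ D.βfun` ∧ `FadingMemory C θ Λ`; the AF
binders `EventualLowerH b γ k₀ D.βfun` (`b > 0`) and `BetaUpperH β′ γ D.βfun` with `γ²β′ < 1`; a sequence `g₀` tuned to `g` within `]0,γ]`; the window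
`C·((k₀+1)γ³ + 2γ∕b) ≤ (1−θ)∕2`.  THEN node U2's output on the data, `U2Output D g₀ (2c∕(1−θ)) θ` (K-uniform geometric matching of the couplings of
CONSECUTIVE tuned runs — node U6's input).  Compare `Spine/NE4/Targets.u2Output_of_u2Inputs` (same conclusion from the BOX letter `ScaleShiftRate c θ γ D.βfun`):
here N17 is read only along the sliding windows of honest runs.  Every β-side binder UNPRINTED; bookkeeping. [cite: Balaban1987RG1, (0.20) p.256 and Thm 2 p.259] -/
theorem u2Output_of_runWindowShift (D : FiniteEpsData F G) {γ β' g c θ C b : ℝ} {k₀ : ℕ} {Λ : ℕ → ℕ → ℝ} {a : ℕ → ℝ} {g₀ : ℕ → ℝ}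
    (hW : ∀ (n : ℕ) (gs : ℕ → ℝ), RGEqH n D.βfun gs → Step.InInterval γ n gs → ∀ j k : ℕ, j + (k + 1) ≤ n →
      |D.βfun (k + 1) (prefixOf (fun i => gs (j + i)) (k + 1)) - D.βfun k (prefixOf (fun i => gs (j + 1 + i)) k)| ≤ a k)
    (hac : ∀ k, a k ≤ c * θ ^ k) (hθ0 : 0 < θ) (hθ1 : θ < 1) (hc : 0 ≤ c)
    (hL : HistLipschitz Λ γ D.βfun) (hΛ : FadingMemory C θ Λ)
    (hγ : 0 < γ) (hb : 0 < b) (hlo : EventualLowerH b γ k₀ D.βfun)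
    (hhi : BetaUpperH β' γ D.βfun) (hγβ : γ ^ 2 * β' < 1) (ht : D.Tuned γ g g₀)
    (hsmall : C * (((k₀ : ℝ) + 1) * γ ^ 3 + 2 * γ / b) ≤ (1 - θ) / 2) :
    U2Output D g₀ (2 * c / (1 - θ)) θ :=
  u2Output_of_ne4AlongRuns D
    (fun K j hj => (shiftAlongRun_runFlow_of_runWindowShift D hW hγ hhi hγβ ht K j hj).trans (hac j))
    hθ0 hθ1 hc hL hΛ hγ hb hlo hhi hγβ ht hsmall

/-- ★★ **K3's `hU2` SLOT SHAPE FROM THE RUN-WINDOW N17 TEXT** — the twin of `Spine/NE4/Targets.u2Output_under` with the BOX letter replaced by the RUN-WINDOW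
text.  With the run-window text for `D.βfun` given at ONE level `γᵤ` (geometric modulus `a_k ≤ cθ^k`), the history half, `EventualLowerH b γᵤ k₀`, the
printed-type `BetaUpperH β′ γᵤ` with `γᵤ²β′ < 1` and the window `C·((k₀+1)γᵤ³ + 2γᵤ∕b) ≤ (1−θ)∕2` there, node U2's output holds UNDER THE TARGETS' QUANTIFIER
PREFIX: `D.UnderHypotheses Hβ (fun g₀ ↦ U2Output D g₀ (2c∕(1−θ)) θ)` — for every `γ ≤ γᵤ`, every `g` and every sequence tuned to `g` within `]0,γ]`
(threshold `γ₀ := γᵤ`, idle `g₁ := 1`), whatever `Hβ` and (B) are (not used).  This is the N27 ledger joins' `hU2` slot shape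
(`…N17KnitTransfer.u2Output_under_of_u2Inputs_gap` supplies it from the box triple; this seat's g3 FILE 2 from the K3 pin).  Monotonicity in `γ`: an
in-window run at level `γ ≤ γᵤ` is one at level `γᵤ`, `FlowStep.box_mono` for the box-keyed companions.  Every β-side binder UNPRINTED; under the ym-nodeO
F-E finding `FadingMemory` is the presumptively-dead binder here as in the box road — displayed, not repaired. [cite: Balaban1987RG1, (0.20) p.256 and Thm 2 p.259] -/
theorem underHypotheses_u2Output_of_runWindowShift (D : FiniteEpsData F G) {Hβ : Prop} {γu β' c θ C b : ℝ} {k₀ : ℕ}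
    {Λ : ℕ → ℕ → ℝ} {a : ℕ → ℝ}
    (hW : ∀ (n : ℕ) (gs : ℕ → ℝ), RGEqH n D.βfun gs → Step.InInterval γu n gs → ∀ j k : ℕ, j + (k + 1) ≤ n →
      |D.βfun (k + 1) (prefixOf (fun i => gs (j + i)) (k + 1)) - D.βfun k (prefixOf (fun i => gs (j + 1 + i)) k)| ≤ a k)
    (hac : ∀ k, a k ≤ c * θ ^ k) (hθ0 : 0 < θ) (hθ1 : θ < 1) (hc : 0 ≤ c)
    (hL : HistLipschitz Λ γu D.βfun) (hΛ : FadingMemory C θ Λ) (hγu : 0 < γu) (hb : 0 < b)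
    (hlo : EventualLowerH b γu k₀ D.βfun) (hhi : BetaUpperH β' γu D.βfun) (hγβ : γu ^ 2 * β' < 1)
    (hsmall : C * (((k₀ : ℝ) + 1) * γu ^ 3 + 2 * γu / b) ≤ (1 - θ) / 2) :
    D.UnderHypotheses Hβ fun g₀ => U2Output D g₀ (2 * c / (1 - θ)) θ := by
  intro _ _
  refine ⟨γu, hγu, fun γ hγ hγle => ⟨1, one_pos, fun g _ _ g₀ ht => ?_⟩⟩
  -- every binder restricts from `]0,γᵤ]` to `]0,γ]`
  have hW' : ∀ (n : ℕ) (gs : ℕ → ℝ), RGEqH n D.βfun gs → Step.InInterval γ n gs → ∀ j k : ℕ, j + (k + 1) ≤ n →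
      |D.βfun (k + 1) (prefixOf (fun i => gs (j + i)) (k + 1)) - D.βfun k (prefixOf (fun i => gs (j + 1 + i)) k)| ≤ a k :=
    fun n gs hrg hI => hW n gs hrg fun i hi => ⟨(hI i hi).1, (hI i hi).2.trans hγle⟩
  have hL' : HistLipschitz Λ γ D.βfun := fun k p q hp hq => hL k p q (box_mono hγle k hp) (box_mono hγle k hq)
  have hlo' : EventualLowerH b γ k₀ D.βfun := fun k v hk hv => hlo k v hk (box_mono hγle k hv)
  have hhi' : BetaUpperH β' γ D.βfun := fun k v hv => hhi k v (box_mono hγle k hv)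
  have hγβ' : γ ^ 2 * β' < 1 := by
    rcases le_or_gt β' 0 with hβ | hβ
    · exact lt_of_le_of_lt (mul_nonpos_of_nonneg_of_nonpos (sq_nonneg γ) hβ) one_pos
    · exact lt_of_le_of_lt (mul_le_mul_of_nonneg_right (pow_le_pow_left₀ hγ.le hγle 2) hβ.le) hγβ
  have hmono : ((k₀ : ℝ) + 1) * γ ^ 3 + 2 * γ / b ≤ ((k₀ : ℝ) + 1) * γu ^ 3 + 2 * γu / b :=
    add_le_add (mul_le_mul_of_nonneg_left (pow_le_pow_left₀ hγ.le hγle 3) (by positivity))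
      (div_le_div_of_nonneg_right (mul_le_mul_of_nonneg_left hγle zero_le_two) hb.le)
  have hC : 0 ≤ C := by
    have h0 := hΛ 0 0 le_rfl
    simpa using h0.1.trans h0.2
  have hsmall' : C * (((k₀ : ℝ) + 1) * γ ^ 3 + 2 * γ / b) ≤ (1 - θ) / 2 :=
    (mul_le_mul_of_nonneg_left hmono hC).trans hsmall
  exact u2Output_of_runWindowShift D hW' hac hθ0 hθ1 hc hL' hΛ hγ hb hlo' hhi' hγβ' ht hsmall'

/-- ★★ **K3's `hU2` CONCLUSION ON THE AF-FREE RATE-LOSS ROAD FROM THE RUN-WINDOW TEXT** (twin of `…N17KnitTransfer.u2Output_of_N17_gap` with the box letter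
`NE4OnData D c θ γ` replaced by the run-window text; `disc_le_gap_of_runWindowShift` run by run).  The run-window text for `D.βfun` at level `γ` with `a_k ≤ cθ^k`;
the history half with memory rate `ω < ρ`, output rate `ρ ∈ [θ,1[`; the printed-type `BetaUpperH β′ γ` with `γ²β′ < 1` (only to run (0.20) forward); a sequence tuned to
`g` within `]0,γ]`; the γ³-window `C·γ³·ρ∕(ρ−ω) ≤ (1−ρ)∕2`.  THEN `U2Output D g₀ (2c∕(1−ρ)) ρ`.  NO `EventualLowerH`, NO `b`, NO `k₀`.  Every β-side binder UNPRINTED.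
[cite: Balaban1987RG1, (0.20) p.256 and Thm 2 p.259] -/
theorem u2Output_of_runWindowShift_gap (D : FiniteEpsData F G) {γ β' g c θ ω ρ C : ℝ} {Λ : ℕ → ℕ → ℝ} {a : ℕ → ℝ} {g₀ : ℕ → ℝ}
    (hW : ∀ (n : ℕ) (gs : ℕ → ℝ), RGEqH n D.βfun gs → Step.InInterval γ n gs → ∀ j k : ℕ, j + (k + 1) ≤ n →
      |D.βfun (k + 1) (prefixOf (fun i => gs (j + i)) (k + 1)) - D.βfun k (prefixOf (fun i => gs (j + 1 + i)) k)| ≤ a k)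
    (hac : ∀ k, a k ≤ c * θ ^ k) (hρ0 : 0 < ρ) (hρ1 : ρ < 1) (hθ0 : 0 ≤ θ) (hθρ : θ ≤ ρ) (hω0 : 0 ≤ ω) (hωρ : ω < ρ)
    (hc : 0 ≤ c) (hC : 0 ≤ C) (hL : HistLipschitz Λ γ D.βfun) (hΛ : FadingMemory C ω Λ)
    (hγ : 0 < γ) (hhi : BetaUpperH β' γ D.βfun) (hγβ : γ ^ 2 * β' < 1) (ht : D.Tuned γ g g₀)
    (hsmall : C * γ ^ 3 * (ρ / (ρ - ω)) ≤ (1 - ρ) / 2) :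
    U2Output D g₀ (2 * c / (1 - ρ)) ρ := by
  obtain ⟨hbox, hpin⟩ := box_and_pin_of_tuned D ht
  have hrun : ∀ K, RGEqH K D.βfun (runFlow D g₀ K) := fun K => rgEqH_of_tuned D hhi hγβ hγ le_rfl ht K
  intro K j hj
  refine ⟨disc_nonneg _ _ _, ?_⟩
  have h := disc_le_gap_of_runWindowShift hW hac hρ0 hρ1 hθ0 hθρ hω0 hωρ hc hC (hrun K) (hrun (K + 1))
    (hbox K) (hbox (K + 1)) ((hpin K).trans (hpin (K + 1)).symm) hL hΛ hsmall j hj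
  simpa using h

/-- ★★★ **K3's `hU2` SLOT SHAPE ON THE AF-FREE ROAD FROM THE RUN-WINDOW TEXT, THE WINDOW DISCHARGED BY γ SMALL** — the twin of the slot's supplier of
record `…N17KnitTransfer.u2Output_under_of_N17_gap` (consumed by dag-n27-a's ledger joins at `Hβ := EndpointExistence`, and reached from the K3 pin by this seat's
g3 FILE 2 `underHypotheses_u2Output_of_keyedP_fsc_pin`) with the box letter `NE4OnData D c θ γᵤ` replaced by the RUN-WINDOW N17 text at level `γᵤ`.  With the
history half on `]0,γᵤ]` (memory rate `ω < ρ`, output rate `ρ ∈ [θ,1[`) and the printed-type `BetaUpperH β′ γᵤ` with `γᵤ²β′ < 1`: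
`D.UnderHypotheses Hβ (fun g₀ ↦ U2Output D g₀ (2c∕(1−ρ)) ρ)` with threshold `γ₀ := min(γᵤ, 1, (1−ρ)(ρ−ω)∕(ρ(2C+1)))` — every binder restricted to the run box
(`FlowStep.box_mono`; an in-window run at level `γ ≤ γᵤ` is one at level `γᵤ`), the γ³-window by `gapWindow_of_small_box` at constant `2C`.  NO `EventualLowerH`, NO window
binder, NO (B) ∕ `Hβ` used.  Every β-side binder UNPRINTED; under the ym-nodeO F-E finding `FadingMemory` is the presumptively-dead binder, displayed not repaired.
[cite: Balaban1987RG1, (0.20) p.256 and Thm 2 p.259] -/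
theorem underHypotheses_u2Output_of_runWindowShift_gap (D : FiniteEpsData F G) {Hβ : Prop} {γu β' c θ ω ρ C : ℝ}
    {Λ : ℕ → ℕ → ℝ} {a : ℕ → ℝ}
    (hW : ∀ (n : ℕ) (gs : ℕ → ℝ), RGEqH n D.βfun gs → Step.InInterval γu n gs → ∀ j k : ℕ, j + (k + 1) ≤ n →
      |D.βfun (k + 1) (prefixOf (fun i => gs (j + i)) (k + 1)) - D.βfun k (prefixOf (fun i => gs (j + 1 + i)) k)| ≤ a k)
    (hac : ∀ k, a k ≤ c * θ ^ k) (hρ0 : 0 < ρ) (hρ1 : ρ < 1) (hθ0 : 0 ≤ θ) (hθρ : θ ≤ ρ) (hω0 : 0 ≤ ω) (hωρ : ω < ρ)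
    (hc : 0 ≤ c) (hC : 0 ≤ C) (hL : HistLipschitz Λ γu D.βfun) (hΛ : FadingMemory C ω Λ) (hγu : 0 < γu)
    (hhi : BetaUpperH β' γu D.βfun) (hγβ : γu ^ 2 * β' < 1) :
    D.UnderHypotheses Hβ fun g₀ => U2Output D g₀ (2 * c / (1 - ρ)) ρ := by
  intro _ _
  have hWpos : 0 < (1 - ρ) * (ρ - ω) / (ρ * (2 * C + 1)) :=
    div_pos (mul_pos (by linarith) (by linarith)) (mul_pos hρ0 (by linarith))
  refine ⟨min γu (min 1 ((1 - ρ) * (ρ - ω) / (ρ * (2 * C + 1)))), lt_min hγu (lt_min one_pos hWpos),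
    fun γ hγ hγle => ⟨1, one_pos, fun g _ _ g₀ ht => ?_⟩⟩
  have hγu' : γ ≤ γu := hγle.trans (min_le_left _ _)
  have hγ1 : γ ≤ 1 := hγle.trans ((min_le_right _ _).trans (min_le_left _ _))
  have hγW : γ ≤ (1 - ρ) * (ρ - ω) / (ρ * (2 * C + 1)) := hγle.trans ((min_le_right _ _).trans (min_le_right _ _))
  -- every binder restricts from `]0,γᵤ]` to the run box `]0,γ]`
  have hW' : ∀ (n : ℕ) (gs : ℕ → ℝ), RGEqH n D.βfun gs → Step.InInterval γ n gs → ∀ j k : ℕ, j + (k + 1) ≤ n →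
      |D.βfun (k + 1) (prefixOf (fun i => gs (j + i)) (k + 1)) - D.βfun k (prefixOf (fun i => gs (j + 1 + i)) k)| ≤ a k :=
    fun n gs hrg hI => hW n gs hrg fun i hi => ⟨(hI i hi).1, (hI i hi).2.trans hγu'⟩
  have hγβ' : γ ^ 2 * β' < 1 := by
    rcases le_or_gt β' 0 with hβ | hβ
    · exact lt_of_le_of_lt (mul_nonpos_of_nonneg_of_nonpos (sq_nonneg γ) hβ) one_pos
    · exact lt_of_le_of_lt (mul_le_mul_of_nonneg_right (pow_le_pow_left₀ hγ.le hγu' 2) hβ.le) hγβ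
  have hwin : C * γ ^ 3 * (ρ / (ρ - ω)) ≤ (1 - ρ) / 2 := by
    have h := gapWindow_of_small_box (C := 2 * C) (by positivity) hωρ hρ0 hρ1 hγ hγ1 hγW
    have e : 2 * C * (γ ^ 3 / 2) * (ρ / (ρ - ω)) = C * γ ^ 3 * (ρ / (ρ - ω)) := by ring
    linarith [h, e]
  exact u2Output_of_runWindowShift_gap D hW' hac hρ0 hρ1 hθ0 hθρ hω0 hωρ hc hC
    (fun k p q hp hq => hL k p q (box_mono hγu' k hp) (box_mono hγu' k hq)) hΛ hγ
    (fun k v hv => hhi k v (box_mono hγu' k hv)) hγβ' ht hwin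

/-- **THE SUMMABLE-MODULUS FACE ON THE DATA** (`Support/NE7MarginalL1Runs.disc_runs_le_smear_fadingMemory` BY NAME): the run-window text for `D.βfun` at level `γ`
with ANY modulus `a ≥ 0`, the history half with memory rate `ω ∈ ]0,1[`, the AF binders and the window `C·((k₀+1)γ³ + 2γ∕b) ≤ (1−ω)∕2` give, along every sequence
tuned within `]0,γ]`, the NE7-ℓ¹ lineage's shape `SmearDominated 2 ω a` for the discrepancies of CONSECUTIVE tuned runs:
`0 ≤ disc (g^{(K)}) (g^{(K+1)}) j ≤ 2·Σ_{l<K} a_l·ω^{(j−l)₊}` (`j ≤ K`).  Every β-side binder UNPRINTED. [cite: Balaban1987RG1, (0.20) p.256 and Thm 2 p.259] -/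
theorem smearDominated_disc_of_runWindowShift (D : FiniteEpsData F G) {γ β' g ω C b : ℝ} {k₀ : ℕ} {Λ : ℕ → ℕ → ℝ} {a : ℕ → ℝ}
    {g₀ : ℕ → ℝ}
    (hW : ∀ (n : ℕ) (gs : ℕ → ℝ), RGEqH n D.βfun gs → Step.InInterval γ n gs → ∀ j k : ℕ, j + (k + 1) ≤ n →
      |D.βfun (k + 1) (prefixOf (fun i => gs (j + i)) (k + 1)) - D.βfun k (prefixOf (fun i => gs (j + 1 + i)) k)| ≤ a k)
    (ha0 : ∀ k, 0 ≤ a k) (hω0 : 0 < ω) (hω1 : ω < 1) (hC : 0 ≤ C)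
    (hL : HistLipschitz Λ γ D.βfun) (hΛ : FadingMemory C ω Λ)
    (hγ : 0 < γ) (hb : 0 < b) (hlo : EventualLowerH b γ k₀ D.βfun)
    (hhi : BetaUpperH β' γ D.βfun) (hγβ : γ ^ 2 * β' < 1) (ht : D.Tuned γ g g₀)
    (hsmall : C * (((k₀ : ℝ) + 1) * γ ^ 3 + 2 * γ / b) ≤ (1 - ω) / 2) :
    SmearDominated 2 ω a fun K j => disc (runFlow D g₀ K) (runFlow D g₀ (K + 1)) j := by
  obtain ⟨hbox, hpin⟩ := box_and_pin_of_tuned D ht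
  have hrun : ∀ K, RGEqH K D.βfun (runFlow D g₀ K) := fun K => rgEqH_of_tuned D hhi hγβ hγ le_rfl ht K
  intro K j hj
  have h := disc_runs_le_smear_fadingMemory (runFlow D g₀) g hγ hb hω0 hω1 hC ha0 hrun hbox hpin
    (fun K j hj => shiftAlongRun_runFlow_of_runWindowShift D hW hγ hhi hγβ ht K j hj) hL hΛ hlo hsmall K j hj
  simpa only [smear] using h

/-- **… HENCE NODE U6's SUMMABLE TRANSPORTED TOTALS** (`Support/NE7MarginalL1Currency.summable_delta_of_smearDominated` BY NAME): if moreover the run-window modulus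
is SUMMABLE (`Σ a < ∞` — the located design input R-N17-RUN «re-key N17 run-wise with a summable modulus»), then for every contraction `ρ ∈ [0,1[` and
`E ≥ 0` the transported totals `T4CauchySum.delta E ρ` of the consecutive-run discrepancies are SUMMABLE over `K` — node U6's Cauchy-sum input in the ℓ¹
currency (`T4CauchySum.cauchySum` ∕ `NE7MarginalL1Assembly`), NOT the geometric `U2Output` (which a non-geometric `a` cannot give: `Necessity.ne4AlongRuns_of_u2Output`).
Every β-side binder UNPRINTED; bookkeeping. [cite: Balaban1987RG1, (0.20) p.256 and Thm 2 p.259] -/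
theorem summable_delta_of_runWindowShift (D : FiniteEpsData F G) {γ β' g ω C b E ρ : ℝ} {k₀ : ℕ} {Λ : ℕ → ℕ → ℝ} {a : ℕ → ℝ}
    {g₀ : ℕ → ℝ}
    (hW : ∀ (n : ℕ) (gs : ℕ → ℝ), RGEqH n D.βfun gs → Step.InInterval γ n gs → ∀ j k : ℕ, j + (k + 1) ≤ n →
      |D.βfun (k + 1) (prefixOf (fun i => gs (j + i)) (k + 1)) - D.βfun k (prefixOf (fun i => gs (j + 1 + i)) k)| ≤ a k)
    (ha0 : ∀ k, 0 ≤ a k) (hs : Summable a) (hω0 : 0 < ω) (hω1 : ω < 1) (hC : 0 ≤ C)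
    (hL : HistLipschitz Λ γ D.βfun) (hΛ : FadingMemory C ω Λ)
    (hγ : 0 < γ) (hb : 0 < b) (hlo : EventualLowerH b γ k₀ D.βfun)
    (hhi : BetaUpperH β' γ D.βfun) (hγβ : γ ^ 2 * β' < 1) (ht : D.Tuned γ g g₀)
    (hsmall : C * (((k₀ : ℝ) + 1) * γ ^ 3 + 2 * γ / b) ≤ (1 - ω) / 2) (hE : 0 ≤ E) (hρ0 : 0 ≤ ρ) (hρ1 : ρ < 1) :
    Summable (T4CauchySum.delta E ρ fun K j => disc (runFlow D g₀ K) (runFlow D g₀ (K + 1)) j) :=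
  summable_delta_of_smearDominated
    (smearDominated_disc_of_runWindowShift D hW ha0 hω0 hω1 hC hL hΛ hγ hb hlo hhi hγβ ht hsmall)
    hE zero_le_two ha0 hs hρ0 hρ1 hω0.le hω1

end OnData

end YMDAG.N17.RunWindowU2Door

end
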